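import Literature.NumberTheory.Sieve.HeathBrownCubicApproxS4
import HarnessLib
import Literature.NumberTheory.Sieve.HeathBrownCubicApproxUCore

/-!
# Heath-Brown's Lemma 3.7 from Lemma 7.1, III: pattern weights, and (E2), (E5) through Lemma 7.1

Pure-proof file (no definitions) in the deduction of **Lemma 3.7 from the corrected Lemma 7.1** of
D. R. Heath-Brown, *Primes represented by `x³ + 2y³`*, Acta Math. 186 (2001), 1–84, §7 pp. 42–47
(decomposition of **parity.S18**, `Literature.NumberTheory.Sieve.setOf_prime_cube_add_two_mul_cube_infinite`).
The raw inequality `U_abs_sub_le` of `HeathBrownCubicApproxUCore` bounds `|U₁^(n) − Û^(n)|` by five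
error sources (E1)–(E5). Here the two that involve only sifting functions of GOOD chain ideals —
(E2), the unmatched good indices in the six edge/close classes, and (E5), the weight error — are
estimated by the corrected Lemma 7.1 (`normIn` form, hypothesis `h7`) and the bookkeeping of
(7.1)–(7.4), pp. 42–44, on the RATIONAL side: a good chain ideal `P_1⋯P_{n+1}` has square-free norm
`∏σ` where `σ = {N(P_i)}` is an `(n+1)`-subset of `P0 = {X^τ ≤ p < X^{1−τ}}`, the weight
`∑_{N(Q)∈𝒬} N(Q)^{-1}` is `≤ ∑_σ ∏_{p∈σ} c_K(p)/p`, and each edge/close class singles out one or two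
members of `σ` in a window (fixed, or floating with the other members, p. 43: "`Y ≤ N(P_1) < YX^ξ`.
Here `Y` may depend on `N(P_i)` for `i ≥ 2`"), leaving an elementary symmetric sum `e_n`, `e_{n−1}` of
the weights over `P0` — bounded later by `(∑_{P0} c_K(p)/p)^j/j!` with the SHARP Mertens total
`∑_{P0} c_K(p)/p ≤ log(2/τ) + O(1/(τ log X))`.

## Content (namespace `Literature.NumberTheory.Sieve.CubicSieve`), everything PROVED

* rational side: `floating_window_normWt_le` ((7.1) for a window `lo' < p ≤ hi'` of primes `≥ X^τ`:
  weight `≤ 2(log(hi'/lo') + C₁)/(τ log X)`), `smallPrimes_normWt_le` ((7.2):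
  `∑_{P0} c_K(p)/p ≤ log(2/τ) + 2C₁/(τ log X)`), `sum_filter_or_le`, `sum_class_window_le`,
  `sum_class_floating_le`, `sum_class_close_le` (the selector lemmas of `HeathBrownCubicChainSums`
  dressed with the window weights);
* patterns of chain indices: `mem_P0_iff`, `pattern_props`, `sum_image_absNorm_uIdeal_le`,
  `image_pattern_subset`, `pattern_max_min`, `classC_window`, `classD_window`, `classF_window`
  (the floating windows of classes (c), (d), (f) read off the chain conditions);
* through Lemma 7.1: `sum_good_family_le` (a family of good chain ideals with `N ≤ X^{3/2−τ}` at level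
  `X^τ`: `≤ C₇ (M/(τ log X)) · (pattern weight) + 3 log X · C₇ Err`), **`E2_pattern_weight_le`**
  (`≤ 5B_w e_n + (∑_{P0} w) B_w e_{n−1}`, `B_w = 2((n+1)ξ log X + log 2 + C₁)/(τ log X)`),
  `toPair_good`, **`E5_le`** (`≤ C₇ (M/(τ log X)) e_{n+1} + 3 log X · C₇ Err`).

## References

* D. R. Heath-Brown, *Primes represented by `x³ + 2y³`*, Acta Math. 186 (2001), 1–84: §7 (7.1)–(7.4),
  pp. 42–44. [cite: HeathBrownActa2001, §7 pp. 42–44]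
* G. Harman, *Prime-Detecting Sieves*, LMS Monographs 33, Princeton (2007), §13.2. [cite: Harman2007, §13.2]

## Mathlib / tree search

Mathlib: `Finset.max'`/`min'`, `Finset.mul_prod_erase`, `Finset.erase_right_comm`,
`Finset.card_le_one`, `Classical.choose_spec`, `Real.log_le_sub_one_of_pos`. Tree:
`HeathBrownCubicChainSums` (`sum_sel_le`, `sum_sel₂_le`, `esymm_nonneg`, `sum_image_prod_normWt_le`,
`log_log_div_log_le`), `HeathBrownCubicApproxS4` (`sum_le_of_image_normIn`), `HeathBrownCubicApproxUCore`
(`U_index_props`, `toPair_mem`, `toPair_injOn`), `HeathBrownCubicUpperBoundTools` (`uIdeal_injOn`,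
`squarefree_absNorm_uIdeal`, `UGood`, `sum_union_le_add`), `HeathBrownCubicUpperBoundWeights`
(`ten_le_log`, `log_div_log_two_add_one_le`).
-/

noncomputable section

open Polynomial NumberField Finset Filter Topology Asymptotics
open scoped nonZeroDivisors

namespace Literature.NumberTheory.Sieve.CubicSieve

open LFunctions.CubeRootTwoField CubicPrimes
open Literature.NumberTheory.LFunctions (idealNormCount)

section Weights

variable {C₁ : ℝ}

/-- **Floating Mertens window.** For `X^τ ≥ 4` and a set `T` of primes `p ≥ X^τ` lying in a window
`lo' < p ≤ hi'` (`0 < lo' ≤ hi'`, position arbitrary),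
`∑_{p∈T} c_K(p)/p ≤ 2(log(hi'/lo') + C₁)/(τ log X)` — (7.1), p. 42: "If `z ≥ X^τ` we have
`∑_{z ≤ N(P) < zX^ξ} N(P)^{-1} ≪ ξτ^{-1}`" (here with the window ratio `hi'/lo'` in place of `X^ξ`,
so that it also serves the windows "`Y ≤ N(P_1) < YX^ξ` where `Y` may depend on `N(P_i)` for `i ≥ 2`",
p. 43). [cite: HeathBrownActa2001, §7 (7.1)] -/
theorem floating_window_normWt_le (hC₁ : 0 ≤ C₁)
    (hwin : ∀ (lo hi : ℝ) (T : Finset ℕ), 2 ≤ lo → lo ≤ hi →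
      (∀ p ∈ T, p.Prime ∧ lo < (p : ℝ) ∧ (p : ℝ) ≤ hi) →
      ∑ p ∈ T, (idealNormCount K p : ℝ) * (p : ℝ)⁻¹ ≤
        Real.log (Real.log hi / Real.log lo) + C₁ / Real.log lo)
    {X τ lo' hi' : ℝ} (hX : 1 < X) (hτ : 0 < τ) (hXτ : 4 ≤ X ^ τ) (hlo' : 0 < lo') (hle : lo' ≤ hi')
    (T : Finset ℕ) (hT : ∀ p ∈ T, p.Prime ∧ X ^ τ ≤ (p : ℝ) ∧ lo' < (p : ℝ) ∧ (p : ℝ) ≤ hi') :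
    ∑ p ∈ T, (idealNormCount K p : ℝ) * (p : ℝ)⁻¹ ≤
      2 * (Real.log (hi' / lo') + C₁) / (τ * Real.log X) := by
  classical
  have hX0 : 0 < X := by linarith
  have hL : 0 < Real.log X := Real.log_pos hX
  have hτL : 0 < τ * Real.log X := by positivity
  have hlog0 : 0 ≤ Real.log (hi' / lo') := Real.log_nonneg (by rw [le_div_iff₀ hlo', one_mul]; exact hle)
  have hRHS : 0 ≤ 2 * (Real.log (hi' / lo') + C₁) / (τ * Real.log X) := by positivity
  by_cases hTe : T = ∅
  · rw [hTe, sum_empty]; exact hRHS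
  obtain ⟨p₀, hp₀⟩ := nonempty_iff_ne_empty.mpr hTe
  obtain ⟨-, hp₀τ, -, hp₀hi⟩ := hT p₀ hp₀
  set lo : ℝ := max lo' (X ^ τ / 2) with hlo
  have hlo2 : 2 ≤ lo := le_trans (by linarith) (le_max_right _ _)
  have hlohi : lo ≤ hi' := max_le hle (by linarith)
  have hT' : ∀ p ∈ T, p.Prime ∧ lo < (p : ℝ) ∧ (p : ℝ) ≤ hi' := by
    intro p hp
    obtain ⟨hpp, hpτ, hplo, hphi⟩ := hT p hp
    exact ⟨hpp, max_lt hplo (by linarith), hphi⟩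
  have h := hwin lo hi' T hlo2 hlohi hT'
  have hlo1 : 1 < lo := by linarith
  have hloglo : τ * Real.log X / 2 ≤ Real.log lo := by
    have h1 : Real.log (X ^ τ / 2) ≤ Real.log lo :=
      Real.log_le_log (by positivity) (le_max_right _ _)
    rw [Real.log_div (by positivity) two_ne_zero, Real.log_rpow hX0] at h1
    have hl2 : Real.log 2 ≤ τ * Real.log X / 2 := by
      have h4 : Real.log 4 ≤ Real.log (X ^ τ) := Real.log_le_log (by norm_num) hXτ
      rw [Real.log_rpow hX0, show (4 : ℝ) = 2 ^ 2 by norm_num, Real.log_pow] at h4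
      push_cast at h4; linarith
    linarith
  have hloglo0 : 0 < Real.log lo := Real.log_pos hlo1
  have h1 : Real.log (Real.log hi' / Real.log lo) ≤ Real.log (hi' / lo') / Real.log lo := by
    refine (log_log_div_log_le hlo1 hlohi).trans (div_le_div_of_nonneg_right ?_ hloglo0.le)
    refine Real.log_le_log (div_pos (by linarith) (by linarith)) ?_
    exact div_le_div_of_nonneg_left (by linarith) hlo' (le_max_left _ _)
  calc ∑ p ∈ T, (idealNormCount K p : ℝ) * (p : ℝ)⁻¹
      ≤ Real.log (hi' / lo') / Real.log lo + C₁ / Real.log lo := by linarith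
    _ = (Real.log (hi' / lo') + C₁) / Real.log lo := by rw [add_div]
    _ ≤ (Real.log (hi' / lo') + C₁) / (τ * Real.log X / 2) :=
        div_le_div_of_nonneg_left (by positivity) (by positivity) hloglo
    _ = 2 * (Real.log (hi' / lo') + C₁) / (τ * Real.log X) := by
        field_simp

/-- **The total weight of the small primes** ((7.2), sharp form):
`∑_{X^τ ≤ p < X^{1−τ}} c_K(p)/p ≤ log(2/τ) + 2C₁/(τ log X)` for `X^τ ≥ 4` — the paper's
`∑_{X^τ ≤ N(P) < X^{1−τ}} N(P)^{-1} ≤ log(τ^{-1} − 1) + O(τ) ≤ log τ^{-1}`; the constant in front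
of the logarithm is `1`. [cite: HeathBrownActa2001, §7 (7.2)] -/
theorem smallPrimes_normWt_le (hC₁ : 0 ≤ C₁)
    (hwin : ∀ (lo hi : ℝ) (T : Finset ℕ), 2 ≤ lo → lo ≤ hi →
      (∀ p ∈ T, p.Prime ∧ lo < (p : ℝ) ∧ (p : ℝ) ≤ hi) →
      ∑ p ∈ T, (idealNormCount K p : ℝ) * (p : ℝ)⁻¹ ≤
        Real.log (Real.log hi / Real.log lo) + C₁ / Real.log lo)
    {X τ : ℝ} (hX : 1 < X) (hτ : 0 < τ) (hτ1 : τ ≤ 1 / 2) (hXτ : 4 ≤ X ^ τ)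
    (T : Finset ℕ) (hT : ∀ p ∈ T, p.Prime ∧ X ^ τ ≤ (p : ℝ) ∧ (p : ℝ) < X ^ (1 - τ)) :
    ∑ p ∈ T, (idealNormCount K p : ℝ) * (p : ℝ)⁻¹ ≤
      Real.log (2 / τ) + 2 * C₁ / (τ * Real.log X) := by
  have hX0 : 0 < X := by linarith
  have hL : 0 < Real.log X := Real.log_pos hX
  set lo : ℝ := X ^ τ / 2 with hlo
  set hi : ℝ := X ^ (1 - τ) with hhi
  have hlo2 : 2 ≤ lo := by rw [hlo]; linarith
  have hτ1' : X ^ τ ≤ X ^ (1 - τ) := Real.rpow_le_rpow_of_exponent_le hX.le (by linarith)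
  have hlohi : lo ≤ hi := by
    have : X ^ τ / 2 ≤ X ^ τ := by linarith [Real.rpow_nonneg hX0.le τ]
    exact this.trans hτ1'
  have hT' : ∀ p ∈ T, p.Prime ∧ lo < (p : ℝ) ∧ (p : ℝ) ≤ hi := fun p hp =>
    ⟨(hT p hp).1, by rw [hlo]; linarith [(hT p hp).2.1], (hT p hp).2.2.le⟩
  have h := hwin lo hi T hlo2 hlohi hT'
  have hl2 : Real.log 2 ≤ τ * Real.log X / 2 := by
    have h4 : Real.log 4 ≤ Real.log (X ^ τ) := Real.log_le_log (by norm_num) hXτ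
    rw [Real.log_rpow hX0, show (4 : ℝ) = 2 ^ 2 by norm_num, Real.log_pow] at h4
    push_cast at h4; linarith
  have hloglo : Real.log lo = τ * Real.log X - Real.log 2 := by
    rw [hlo, Real.log_div (by positivity) two_ne_zero, Real.log_rpow hX0]
  have hloghi : Real.log hi = (1 - τ) * Real.log X := by rw [hhi, Real.log_rpow hX0]
  have hloglo_ge : τ * Real.log X / 2 ≤ Real.log lo := by rw [hloglo]; linarith
  have hτL : 0 < τ * Real.log X := mul_pos hτ hL
  have hloglo0 : 0 < Real.log lo := by linarith
  -- `log hi / log lo ≤ 2/τ`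
  have hratio : Real.log hi / Real.log lo ≤ 2 / τ := by
    rw [div_le_div_iff₀ hloglo0 hτ, hloghi]
    have h1 : τ * Real.log X - (1 - τ) * Real.log X * τ = τ ^ 2 * Real.log X := by ring
    have h2 : 0 ≤ τ ^ 2 * Real.log X := by positivity
    linarith
  have hlog1 : Real.log (Real.log hi / Real.log lo) ≤ Real.log (2 / τ) := by
    refine Real.log_le_log (div_pos ?_ hloglo0) hratio
    rw [hloghi]; exact mul_pos (by linarith) hL
  have hC : C₁ / Real.log lo ≤ 2 * C₁ / (τ * Real.log X) := by
    calc C₁ / Real.log lo ≤ C₁ / (τ * Real.log X / 2) :=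
          div_le_div_of_nonneg_left hC₁ (by positivity) hloglo_ge
      _ = 2 * C₁ / (τ * Real.log X) := by field_simp
  linarith

/-- Sums over a family cut out by a disjunction are at most the sum of the sums over each disjunct
(non-negative summands). [folklore] -/
theorem sum_filter_or_le {α : Type*} (s : Finset α) (f : α → ℝ) (hf : ∀ a ∈ s, 0 ≤ f a)
    (p q : α → Prop) [DecidablePred p] [DecidablePred q] [DecidablePred fun a => p a ∨ q a] :
    ∑ a ∈ s.filter (fun a => p a ∨ q a), f a ≤ ∑ a ∈ s.filter p, f a + ∑ a ∈ s.filter q, f a := by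
  classical
  rw [sum_filter, sum_filter, sum_filter, ← sum_add_distrib]
  refine sum_le_sum fun a ha => ?_
  have h0 := hf a ha
  by_cases hp : p a <;> by_cases hq : q a <;> simp [hp, hq, h0]

variable {X τ : ℝ} {n : ℕ} (P0 : Finset ℕ)

/-- Weights are non-negative on any set. [folklore] -/
theorem normWt_nonneg_on (s : Finset ℕ) : ∀ p ∈ s, 0 ≤ (idealNormCount K p : ℝ) * (p : ℝ)⁻¹ :=
  fun p _ => normWt_nonneg p

/-- **Class (a)/(b): a member in a fixed window.** For a family of `(n+1)`-subsets of `P0` each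
containing a member in a set `W`, the weight is at most `(∑_{W∩P0} w)·e_n(P0)`.
[cite: HeathBrownActa2001, §7 p. 43] -/
theorem sum_class_window_le (A : Finset (Finset ℕ)) (hA : A ⊆ P0.powersetCard (n + 1))
    (W : ℕ → Prop) [DecidablePred W] (hW : ∀ σ ∈ A, ∃ p ∈ σ, W p) {B : ℝ}
    (hB : ∑ p ∈ P0.filter W, (idealNormCount K p : ℝ) * (p : ℝ)⁻¹ ≤ B) :
    ∑ σ ∈ A, ∏ p ∈ σ, (idealNormCount K p : ℝ) * (p : ℝ)⁻¹ ≤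
      B * ∑ σ' ∈ P0.powersetCard n, ∏ p ∈ σ', (idealNormCount K p : ℝ) * (p : ℝ)⁻¹ := by
  classical
  -- select a member in the window
  set sel : Finset ℕ → ℕ := fun σ => if h : ∃ p ∈ σ, W p then Classical.choose h else 0 with hsel
  have hsel_spec : ∀ σ ∈ A, sel σ ∈ σ ∧ W (sel σ) := by
    intro σ hσ
    have h := hW σ hσ
    simp only [hsel, dif_pos h]
    exact (Classical.choose_spec h)
  refine sum_sel_le P0 _ (normWt_nonneg_on P0) n A hA sel (fun σ hσ => (hsel_spec σ hσ).1)
    (fun _ p => W p) (fun σ hσ => (hsel_spec σ hσ).2) fun σ' _ => ?_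
  calc ∑ p ∈ P0.filter (fun p => p ∉ σ' ∧ W p), (idealNormCount K p : ℝ) * (p : ℝ)⁻¹
      ≤ ∑ p ∈ P0.filter W, (idealNormCount K p : ℝ) * (p : ℝ)⁻¹ :=
        sum_le_sum_of_subset_of_nonneg (monotone_filter_right _ fun p _ h => h.2)
          fun p _ _ => normWt_nonneg p
    _ ≤ B := hB

/-- **Classes (c)/(d)/(f): the largest member in a floating window determined by the others.** For a
family of `(n+1)`-subsets of `P0 ⊆ {primes ≥ X^τ}` such that the largest member `p` of each `σ`
satisfies `lo(σ∖p) < p ≤ lo(σ∖p)·ρ` for a function `lo > 0` of the remaining members and a fixed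
ratio `ρ ≥ 1`, the weight is at most `2(log ρ + C₁)/(τ log X) · e_n(P0)` (floating Mertens window,
uniformly in the position). [cite: HeathBrownActa2001, §7 p. 43] -/
theorem sum_class_floating_le (hC₁ : 0 ≤ C₁)
    (hwin : ∀ (lo hi : ℝ) (T : Finset ℕ), 2 ≤ lo → lo ≤ hi →
      (∀ p ∈ T, p.Prime ∧ lo < (p : ℝ) ∧ (p : ℝ) ≤ hi) →
      ∑ p ∈ T, (idealNormCount K p : ℝ) * (p : ℝ)⁻¹ ≤
        Real.log (Real.log hi / Real.log lo) + C₁ / Real.log lo)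
    (hX : 1 < X) (hτ : 0 < τ) (hXτ : 4 ≤ X ^ τ)
    (hP0 : ∀ p ∈ P0, p.Prime ∧ X ^ τ ≤ (p : ℝ))
    (A : Finset (Finset ℕ)) (hA : A ⊆ P0.powersetCard (n + 1))
    (lo : Finset ℕ → ℝ) {ρ : ℝ} (hρ : 1 ≤ ρ)
    (hAw : ∀ σ ∈ A, ∃ h : σ.Nonempty, 0 < lo (σ.erase (σ.max' h)) ∧
      lo (σ.erase (σ.max' h)) < (σ.max' h : ℝ) ∧ (σ.max' h : ℝ) ≤ lo (σ.erase (σ.max' h)) * ρ) :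
    ∑ σ ∈ A, ∏ p ∈ σ, (idealNormCount K p : ℝ) * (p : ℝ)⁻¹ ≤
      2 * (Real.log ρ + C₁) / (τ * Real.log X) *
        ∑ σ' ∈ P0.powersetCard n, ∏ p ∈ σ', (idealNormCount K p : ℝ) * (p : ℝ)⁻¹ := by
  classical
  set sel : Finset ℕ → ℕ := fun σ => if h : σ.Nonempty then σ.max' h else 0 with hsel
  have hsel_eq : ∀ σ ∈ A, ∀ h : σ.Nonempty, sel σ = σ.max' h := by
    intro σ _ h; simp only [hsel, dif_pos h]
  refine sum_sel_le P0 _ (normWt_nonneg_on P0) n A hA sel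
    (fun σ hσ => by
      obtain ⟨h, -⟩ := hAw σ hσ
      rw [hsel_eq σ hσ h]; exact max'_mem _ _)
    (fun σ' p => 0 < lo σ' ∧ lo σ' < (p : ℝ) ∧ (p : ℝ) ≤ lo σ' * ρ)
    (fun σ hσ => by
      obtain ⟨h, h1, h2, h3⟩ := hAw σ hσ
      rw [hsel_eq σ hσ h]; exact ⟨h1, h2, h3⟩)
    fun σ' _ => ?_
  by_cases hlo : 0 < lo σ'
  · have := floating_window_normWt_le hC₁ hwin hX hτ hXτ hlo
      (by nlinarith : lo σ' ≤ lo σ' * ρ)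
      (P0.filter fun p => p ∉ σ' ∧ (0 < lo σ' ∧ lo σ' < (p : ℝ) ∧ (p : ℝ) ≤ lo σ' * ρ))
      (fun p hp => by
        rw [mem_filter] at hp
        exact ⟨(hP0 p hp.1).1, (hP0 p hp.1).2, hp.2.2.2.1, hp.2.2.2.2⟩)
    have hratio : lo σ' * ρ / lo σ' = ρ := by field_simp
    rw [hratio] at this
    exact this
  · have hempty : P0.filter (fun p => p ∉ σ' ∧ (0 < lo σ' ∧ lo σ' < (p : ℝ) ∧ (p : ℝ) ≤ lo σ' * ρ)) = ∅ :=
      filter_eq_empty_iff.mpr fun p _ h => hlo h.2.1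
    rw [hempty, sum_empty]
    have hL : 0 < Real.log X := Real.log_pos hX
    have : 0 ≤ Real.log ρ := Real.log_nonneg hρ
    positivity

/-- **Class (e): two members within a factor `ρ` of each other.** For a family of `(n+2)`-subsets
of `P0 ⊆ {primes ≥ X^τ}` each containing `p < p' ≤ p·ρ`, the weight is at most
`(∑_{P0} w)·2(log ρ + C₁)/(τ log X) · e_n(P0)` (p. 43: "we fix `i`, so that the sum over `P_{i−1}`
produces `O(ξτ^{-1})`, by (7.1). The remaining prime ideals produce a factor `O((log τ^{-1})^n/n!)`").
[cite: HeathBrownActa2001, §7 p. 43] -/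
theorem sum_class_close_le (hC₁ : 0 ≤ C₁)
    (hwin : ∀ (lo hi : ℝ) (T : Finset ℕ), 2 ≤ lo → lo ≤ hi →
      (∀ p ∈ T, p.Prime ∧ lo < (p : ℝ) ∧ (p : ℝ) ≤ hi) →
      ∑ p ∈ T, (idealNormCount K p : ℝ) * (p : ℝ)⁻¹ ≤
        Real.log (Real.log hi / Real.log lo) + C₁ / Real.log lo)
    (hX : 1 < X) (hτ : 0 < τ) (hXτ : 4 ≤ X ^ τ)
    (hP0 : ∀ p ∈ P0, p.Prime ∧ X ^ τ ≤ (p : ℝ))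
    (A : Finset (Finset ℕ)) (hA : A ⊆ P0.powersetCard (n + 2)) {ρ : ℝ} (hρ : 1 ≤ ρ)
    (hAw : ∀ σ ∈ A, ∃ p ∈ σ, ∃ p' ∈ σ, p < p' ∧ (p' : ℝ) ≤ p * ρ) :
    ∑ σ ∈ A, ∏ p ∈ σ, (idealNormCount K p : ℝ) * (p : ℝ)⁻¹ ≤
      (∑ p ∈ P0, (idealNormCount K p : ℝ) * (p : ℝ)⁻¹) * (2 * (Real.log ρ + C₁) / (τ * Real.log X)) *
        ∑ σ' ∈ P0.powersetCard n, ∏ p ∈ σ', (idealNormCount K p : ℝ) * (p : ℝ)⁻¹ := by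
  classical
  set sel₁ : Finset ℕ → ℕ := fun σ =>
    if h : ∃ p ∈ σ, ∃ p' ∈ σ, p < p' ∧ (p' : ℝ) ≤ p * ρ then Classical.choose h else 0 with hsel₁
  set sel₂ : Finset ℕ → ℕ := fun σ =>
    if h : ∃ p ∈ σ, ∃ p' ∈ σ, p < p' ∧ (p' : ℝ) ≤ p * ρ then
      Classical.choose (Classical.choose_spec h).2 else 0 with hsel₂
  have hspec : ∀ σ ∈ A, sel₁ σ ∈ σ ∧ sel₂ σ ∈ σ ∧ sel₁ σ < sel₂ σ ∧ (sel₂ σ : ℝ) ≤ sel₁ σ * ρ := by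
    intro σ hσ
    have h := hAw σ hσ
    simp only [hsel₁, hsel₂, dif_pos h]
    have h1 := Classical.choose_spec h
    have h2 := Classical.choose_spec h1.2
    exact ⟨h1.1, h2.1, h2.2.1, h2.2.2⟩
  set W : ℝ := 2 * (Real.log ρ + C₁) / (τ * Real.log X) with hW
  refine sum_sel₂_le P0 _ (normWt_nonneg_on P0) n A hA sel₁ sel₂
    (fun σ hσ => (hspec σ hσ).1) (fun σ hσ => (hspec σ hσ).2.1)
    (fun σ hσ => (hspec σ hσ).2.2.1.ne)
    (fun p p' => p < p' ∧ (p' : ℝ) ≤ p * ρ) (fun σ hσ => (hspec σ hσ).2.2) ?_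
  -- the double sum over close pairs
  rw [sum_filter, sum_product]
  have hinner : ∀ p ∈ P0, ∑ p' ∈ P0, (if p ≠ p' ∧ (p < p' ∧ (p' : ℝ) ≤ p * ρ) then
      (idealNormCount K p : ℝ) * (p : ℝ)⁻¹ * ((idealNormCount K p' : ℝ) * (p' : ℝ)⁻¹) else 0) ≤
      (idealNormCount K p : ℝ) * (p : ℝ)⁻¹ * W := by
    intro p hp
    rw [← sum_filter, ← mul_sum]
    refine mul_le_mul_of_nonneg_left ?_ (normWt_nonneg p)
    have hp0 : (0 : ℝ) < p := by
      have := (hP0 p hp).2; have h4 : (0:ℝ) < X ^ τ := by linarith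
      linarith
    have := floating_window_normWt_le hC₁ hwin hX hτ hXτ hp0 (by nlinarith : (p : ℝ) ≤ p * ρ)
      (P0.filter fun p' => p ≠ p' ∧ (p < p' ∧ (p' : ℝ) ≤ p * ρ))
      (fun p' hp' => by
        rw [mem_filter] at hp'
        exact ⟨(hP0 p' hp'.1).1, (hP0 p' hp'.1).2, by exact_mod_cast hp'.2.2.1, hp'.2.2.2⟩)
    have hratio : (p : ℝ) * ρ / p = ρ := by field_simp
    rw [hratio] at this
    exact this
  calc ∑ p ∈ P0, ∑ p' ∈ P0, (if (p, p').1 ≠ (p, p').2 ∧ ((p, p').1 < (p, p').2 ∧ ((p, p').2 : ℝ) ≤ (p, p').1 * ρ) then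
        (idealNormCount K (p, p').1 : ℝ) * ((p, p').1 : ℝ)⁻¹ * ((idealNormCount K (p, p').2 : ℝ) * ((p, p').2 : ℝ)⁻¹) else 0)
      ≤ ∑ p ∈ P0, (idealNormCount K p : ℝ) * (p : ℝ)⁻¹ * W := sum_le_sum hinner
    _ = (∑ p ∈ P0, (idealNormCount K p : ℝ) * (p : ℝ)⁻¹) * W := by rw [sum_mul]

end Weights

end Literature.NumberTheory.Sieve.CubicSieve

end


/-! ## Part 2: norm patterns of chain indices -/

noncomputable section

open Polynomial NumberField Finset Filter Topology Asymptotics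
open scoped nonZeroDivisors

namespace Literature.NumberTheory.Sieve.CubicSieve

open LFunctions.CubeRootTwoField CubicPrimes
open Literature.NumberTheory.LFunctions (idealNormCount)

section Patterns

variable {X τ : ℝ} {n : ℕ}

/-- Membership in the set of small rational primes `P0 = {p prime : X^τ ≤ p < X^{1−τ}}` (the norms of
the first-degree members of `𝒫₀`), realised as a filter of `range (⌊X^{1−τ}⌋ + 1)`. [folklore] -/
theorem mem_P0_iff {p : ℕ} :
    p ∈ (range (⌊X ^ (1 - τ)⌋₊ + 1)).filter (fun p : ℕ => p.Prime ∧ X ^ τ ≤ (p : ℝ) ∧ (p : ℝ) < X ^ (1 - τ)) ↔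
      p.Prime ∧ X ^ τ ≤ (p : ℝ) ∧ (p : ℝ) < X ^ (1 - τ) := by
  simp only [mem_filter, mem_range, and_iff_right_iff_imp]
  rintro ⟨-, -, h⟩
  have : p ≤ ⌊X ^ (1 - τ)⌋₊ := Nat.le_floor h.le
  omega

/-- **The norm pattern of a good chain index**: `σ(t) = {N(P_1), …, N(P_{n+1})}` is an
`(n+1)`-subset of `P0` whose product is `N(P_1⋯P_{n+1})`. [cite: HeathBrownActa2001, §7 (7.4)] -/
theorem pattern_props {t : Finset (Ideal (𝓞 K)) × Ideal (𝓞 K)}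
    (ht : t ∈ Upairs X τ n) (hg : UGood t) :
    (insert t.2 t.1).image Ideal.absNorm ⊆
        (range (⌊X ^ (1 - τ)⌋₊ + 1)).filter (fun p : ℕ => p.Prime ∧ X ^ τ ≤ (p : ℝ) ∧ (p : ℝ) < X ^ (1 - τ)) ∧
      #((insert t.2 t.1).image Ideal.absNorm) = n + 1 ∧
      ∏ p ∈ (insert t.2 t.1).image Ideal.absNorm, p = Ideal.absNorm (uIdeal t) ∧
      (insert t.2 t.1).image Ideal.absNorm ∈
        ((range (⌊X ^ (1 - τ)⌋₊ + 1)).filter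
          (fun p : ℕ => p.Prime ∧ X ^ τ ≤ (p : ℝ) ∧ (p : ℝ) < X ^ (1 - τ))).powersetCard (n + 1) := by
  classical
  have hmem := mem_Upairs_iff.mp ht
  have hnot := snd_notMem_fst ht
  have hsmall : ∀ Q ∈ insert t.2 t.1, Q ∈ smallPrimes X τ := by
    intro Q hQ
    rcases mem_insert.mp hQ with rfl | hQ
    · exact hmem.2.1
    · exact (mem_chains_iff.mp hmem.1).1 hQ
  have hsub : (insert t.2 t.1).image Ideal.absNorm ⊆
      (range (⌊X ^ (1 - τ)⌋₊ + 1)).filter (fun p : ℕ => p.Prime ∧ X ^ τ ≤ (p : ℝ) ∧ (p : ℝ) < X ^ (1 - τ)) := by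
    intro p hp
    obtain ⟨Q, hQ, rfl⟩ := mem_image.mp hp
    have h := mem_smallPrimes_iff.mp (hsmall Q hQ)
    exact mem_P0_iff.mpr ⟨hg.1 Q hQ, h.2.2.1, h.2.2.2⟩
  have hcard : #((insert t.2 t.1).image Ideal.absNorm) = n + 1 := by
    rw [card_image_of_injOn hg.2, card_insert_of_notMem hnot, (mem_chains_iff.mp hmem.1).2.1]
  refine ⟨hsub, hcard, ?_, mem_powersetCard.mpr ⟨hsub, hcard⟩⟩
  rw [prod_image hg.2, uIdeal_eq_prod_insert hnot, absNorm_prod]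

/-- The weight of a family of norms coming from good chain indices is at most the pattern weight of
the family of their norm patterns. [cite: HeathBrownActa2001, §7 (7.4)] -/
theorem sum_image_absNorm_uIdeal_le (T : Finset (Finset (Ideal (𝓞 K)) × Ideal (𝓞 K)))
    (hT : ∀ t ∈ T, t ∈ Upairs X τ n ∧ UGood t) :
    ∑ q ∈ T.image (fun t => Ideal.absNorm (uIdeal t)), (idealNormCount K q : ℝ) * (q : ℝ)⁻¹ ≤
      ∑ σ ∈ T.image (fun t => (insert t.2 t.1).image Ideal.absNorm),
        ∏ p ∈ σ, (idealNormCount K p : ℝ) * (p : ℝ)⁻¹ := by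
  classical
  have heq : T.image (fun t => Ideal.absNorm (uIdeal t)) =
      (T.image (fun t => (insert t.2 t.1).image Ideal.absNorm)).image (fun σ => ∏ p ∈ σ, p) := by
    rw [image_image]
    refine image_congr fun t ht => ?_
    simp only [Function.comp_apply]
    exact ((pattern_props (hT t ht).1 (hT t ht).2).2.2.1).symm
  rw [heq]
  refine sum_image_prod_normWt_le _ fun σ hσ p hp => ?_
  obtain ⟨t, ht, rfl⟩ := mem_image.mp hσ
  exact ((mem_P0_iff (X := X) (τ := τ)).mp ((pattern_props (hT t ht).1 (hT t ht).2).1 hp)).1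

/-- Families of patterns of good chain indices are families of `(n+1)`-subsets of `P0`. [folklore] -/
theorem image_pattern_subset (T : Finset (Finset (Ideal (𝓞 K)) × Ideal (𝓞 K)))
    (hT : ∀ t ∈ T, t ∈ Upairs X τ n ∧ UGood t) :
    T.image (fun t => (insert t.2 t.1).image Ideal.absNorm) ⊆
      ((range (⌊X ^ (1 - τ)⌋₊ + 1)).filter
          (fun p : ℕ => p.Prime ∧ X ^ τ ≤ (p : ℝ) ∧ (p : ℝ) < X ^ (1 - τ))).powersetCard (n + 1) := by
  intro σ hσ
  obtain ⟨t, ht, rfl⟩ := mem_image.mp hσ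
  exact (pattern_props (hT t ht).1 (hT t ht).2).2.2.2

/-- The largest norm of a good chain index and the product of the other norms: if `p₁ = max σ(t)` then
`∏ σ(t) = p₁ · ∏ (σ(t) ∖ p₁)`, and for `n ≥ 1` the least norm is `N(t.2) = min σ(t) ∈ σ(t) ∖ p₁` with
`∏(σ(t) ∖ min) = N(∏ t.1)`. [folklore] -/
theorem pattern_max_min {t : Finset (Ideal (𝓞 K)) × Ideal (𝓞 K)}
    (ht : t ∈ Upairs X τ n) (hg : UGood t) :
    ∃ h : ((insert t.2 t.1).image Ideal.absNorm).Nonempty,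
      (∏ p ∈ (insert t.2 t.1).image Ideal.absNorm, (p : ℝ)) =
        (((insert t.2 t.1).image Ideal.absNorm).max' h : ℝ) *
          ∏ p ∈ ((insert t.2 t.1).image Ideal.absNorm).erase (((insert t.2 t.1).image Ideal.absNorm).max' h), (p : ℝ) ∧
      ((insert t.2 t.1).image Ideal.absNorm).min' h = Ideal.absNorm t.2 ∧
      (∏ p ∈ ((insert t.2 t.1).image Ideal.absNorm).erase (Ideal.absNorm t.2), p) = Ideal.absNorm (∏ P ∈ t.1, P) := by
  classical
  have hmem := mem_Upairs_iff.mp ht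
  have hnot := snd_notMem_fst ht
  set σ := (insert t.2 t.1).image Ideal.absNorm with hσ
  have hne : σ.Nonempty := ⟨Ideal.absNorm t.2, mem_image_of_mem _ (mem_insert_self _ _)⟩
  refine ⟨hne, ?_, ?_, ?_⟩
  · rw [mul_prod_erase σ (fun p => (p : ℝ)) (max'_mem σ hne)]
  · refine le_antisymm (min'_le _ _ (mem_image_of_mem _ (mem_insert_self _ _))) ?_
    refine le_min' _ _ _ fun w hw => ?_
    obtain ⟨Q, hQ, rfl⟩ := mem_image.mp hw
    rcases mem_insert.mp hQ with rfl | hQ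
    · exact le_rfl
    · exact (hmem.2.2.1 Q hQ).absNorm_le
  · have h1 : σ.erase (Ideal.absNorm t.2) = t.1.image Ideal.absNorm := by
      rw [hσ, image_insert, erase_insert]
      intro h
      obtain ⟨Q, hQ, hQN⟩ := mem_image.mp h
      have : Q = t.2 := hg.2 (mem_insert_of_mem hQ) (mem_insert_self _ _) hQN
      exact hnot (this ▸ hQ)
    rw [h1, prod_image (hg.2.mono (by intro Q hQ; exact mem_insert_of_mem hQ)), absNorm_prod]

/-! ### The windows of the classes (c), (d), (f) read off a chain index -/

/-- **Class (c) window.** For a good chain index with `N(P_1⋯P_n) > X^{1+τ−nξ}` (`n ≥ 1`), the largest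
norm `p₁` lies in `(Y, Y·X^{nξ})` with `Y = X^{1+τ−nξ}/∏_{2 ≤ i ≤ n} p_i` determined by the other
norms (the chain condition gives `N(P_1⋯P_n) < X^{1+τ}`). [cite: HeathBrownActa2001, §7 p. 43] -/
theorem classC_window (hX : 1 < X) (hn : 1 ≤ n) {t : Finset (Ideal (𝓞 K)) × Ideal (𝓞 K)}
    (ht : t ∈ Upairs X τ n) (hg : UGood t)
    (hc : X ^ (1 + τ - n * hbXi τ) < (Ideal.absNorm (∏ P ∈ t.1, P) : ℝ)) :
    ∃ h : ((insert t.2 t.1).image Ideal.absNorm).Nonempty,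
      let σ := (insert t.2 t.1).image Ideal.absNorm
      let σ' := σ.erase (σ.max' h)
      let lo : ℝ := if h' : σ'.Nonempty then
          X ^ (1 + τ - n * hbXi τ) / ∏ p ∈ σ'.erase (σ'.min' h'), (p : ℝ) else 1
      0 < lo ∧ lo < (σ.max' h : ℝ) ∧ (σ.max' h : ℝ) ≤ lo * X ^ (n * hbXi τ) := by
  classical
  have hX0 : 0 < X := by linarith
  obtain ⟨hne, hprod, hmin, hchainprod⟩ := pattern_max_min ht hg
  obtain ⟨-, hcard, -, -⟩ := pattern_props ht hg
  have hmem := mem_Upairs_iff.mp ht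
  refine ⟨hne, ?_⟩
  intro σ σ' lo
  -- `σ'` is nonempty (`n ≥ 1`) and its minimum is `N(t.2)`, the minimum of `σ`
  have hcard' : #σ' = n := by
    show #(σ.erase (σ.max' hne)) = n
    rw [card_erase_of_mem (max'_mem _ _), hcard]; rfl
  have hne' : σ'.Nonempty := card_pos.mp (by rw [hcard']; exact hn)
  have hmaxne : σ.max' hne ≠ Ideal.absNorm t.2 := by
    intro h
    have : #σ ≤ 1 := by
      rw [Finset.card_le_one]
      intro a ha b hb
      have h1 := min'_le σ a ha; have h2 := le_max' σ a ha
      have h3 := min'_le σ b hb; have h4 := le_max' σ b hb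
      rw [hmin] at h1 h3; rw [h] at h2 h4
      omega
    rw [hcard] at this; omega
  have hminmem : Ideal.absNorm t.2 ∈ σ' := by
    show Ideal.absNorm t.2 ∈ σ.erase (σ.max' hne)
    rw [mem_erase]
    exact ⟨hmaxne.symm, by rw [← hmin]; exact min'_mem _ _⟩
  have hmin' : σ'.min' hne' = Ideal.absNorm t.2 := by
    refine le_antisymm (min'_le _ _ hminmem) ?_
    refine le_min' _ _ _ fun w hw => ?_
    rw [← hmin]; exact min'_le _ _ (mem_of_mem_erase hw)
  -- the product over `σ ∖ min` is `p₁ · ∏ (σ' ∖ min)`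
  set D : ℝ := ∏ p ∈ σ'.erase (Ideal.absNorm t.2), (p : ℝ) with hD
  have hp₁mem : σ.max' hne ∈ σ.erase (Ideal.absNorm t.2) := by
    rw [mem_erase]; exact ⟨hmaxne, max'_mem _ _⟩
  have hsplit : (Ideal.absNorm (∏ P ∈ t.1, P) : ℝ) = (σ.max' hne : ℝ) * D := by
    rw [← hchainprod, Nat.cast_prod, ← mul_prod_erase _ (fun p : ℕ => (p : ℝ)) hp₁mem, hD]
    congr 1
    show ∏ x ∈ (σ.erase (Ideal.absNorm t.2)).erase (σ.max' hne), (x : ℝ) =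
      ∏ p ∈ (σ.erase (σ.max' hne)).erase (Ideal.absNorm t.2), (p : ℝ)
    rw [erase_right_comm]
  have hD0 : 0 < D := by
    rw [hD]; refine prod_pos fun p hp => ?_
    have hp' : p ∈ σ := mem_of_mem_erase (mem_of_mem_erase hp)
    obtain ⟨Q, hQ, rfl⟩ := mem_image.mp hp'
    exact_mod_cast (hg.1 Q hQ).pos
  have hlo : lo = X ^ (1 + τ - n * hbXi τ) / D := by
    show (if h' : σ'.Nonempty then X ^ (1 + τ - n * hbXi τ) / ∏ p ∈ σ'.erase (σ'.min' h'), (p : ℝ) else 1) = _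
    rw [dif_pos hne', hmin']
  have hchain : (Ideal.absNorm (∏ P ∈ t.1, P) : ℝ) < X ^ (1 + τ) := by
    have := (mem_chains_iff.mp hmem.1).2.2; exact_mod_cast this
  rw [hlo]
  refine ⟨by positivity, ?_, ?_⟩
  · rw [div_lt_iff₀ hD0, ← hsplit]; exact hc
  · rw [div_mul_eq_mul_div, le_div_iff₀ hD0, ← Real.rpow_add hX0, ← hsplit]
    have : 1 + τ - n * hbXi τ + n * hbXi τ = 1 + τ := by ring
    rw [this]; exact hchain.le

/-- **Class (d) window.** For a good chain index with `X^{1+τ} ≤ N(P_1⋯P_{n+1}) < X^{1+τ+(n+1)ξ}`,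
the largest norm lies in `(Y, Y·2X^{(n+1)ξ}]` with `Y = X^{1+τ}/(2∏_{i≥2} p_i)`.
[cite: HeathBrownActa2001, §7 p. 43] -/
theorem classD_window (hX : 1 < X) {t : Finset (Ideal (𝓞 K)) × Ideal (𝓞 K)}
    (ht : t ∈ Upairs X τ n) (hg : UGood t)
    (hd : (Ideal.absNorm (uIdeal t) : ℝ) < X ^ (1 + τ + (n + 1) * hbXi τ)) :
    ∃ h : ((insert t.2 t.1).image Ideal.absNorm).Nonempty,
      let σ := (insert t.2 t.1).image Ideal.absNorm
      let σ' := σ.erase (σ.max' h)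
      let lo : ℝ := X ^ (1 + τ) / (2 * ∏ p ∈ σ', (p : ℝ))
      0 < lo ∧ lo < (σ.max' h : ℝ) ∧ (σ.max' h : ℝ) ≤ lo * (2 * X ^ ((n + 1) * hbXi τ)) := by
  classical
  have hX0 : 0 < X := by linarith
  obtain ⟨hne, hprod, -, -⟩ := pattern_max_min ht hg
  obtain ⟨-, -, hprodN, -⟩ := pattern_props ht hg
  have hmem := mem_Upairs_iff.mp ht
  refine ⟨hne, ?_⟩
  set σ := (insert t.2 t.1).image Ideal.absNorm with hσ
  set p₁ := σ.max' hne with hp₁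
  set D : ℝ := ∏ p ∈ σ.erase p₁, (p : ℝ) with hD
  have hD0 : 0 < D := by
    rw [hD]; refine prod_pos fun p hp => ?_
    obtain ⟨Q, hQ, rfl⟩ := mem_image.mp (mem_of_mem_erase hp)
    exact_mod_cast (hg.1 Q hQ).pos
  have hN : (Ideal.absNorm (uIdeal t) : ℝ) = p₁ * D := by
    rw [← hprodN, Nat.cast_prod, hprod]
  have hlow : X ^ (1 + τ) ≤ (Ideal.absNorm (uIdeal t) : ℝ) := by
    rw [absNorm_uIdeal]; exact_mod_cast hmem.2.2.2
  simp only
  have hX1τ : 0 < X ^ (1 + τ) := Real.rpow_pos_of_pos hX0 _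
  refine ⟨by positivity, ?_, ?_⟩
  · rw [div_lt_iff₀ (by positivity)]
    rw [hN] at hlow; nlinarith
  · have h1 : X ^ (1 + τ) / (2 * D) * (2 * X ^ ((n + 1) * hbXi τ)) = X ^ (1 + τ + (n + 1) * hbXi τ) / D := by
      rw [Real.rpow_add hX0 (1 + τ) ((n + 1) * hbXi τ)]; field_simp
    rw [h1, le_div_iff₀ hD0, ← hN]; exact hd.le

/-- **Class (f) window.** For a good chain index with `X^{3/2−τ−(n+1)ξ} < N(P_1⋯P_{n+1}) ≤ X^{3/2−τ}`,
the largest norm lies in `(Y, Y·X^{(n+1)ξ}]` with `Y = X^{3/2−τ−(n+1)ξ}/∏_{i≥2} p_i`.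
[cite: HeathBrownActa2001, §7 p. 43] -/
theorem classF_window (hX : 1 < X) {t : Finset (Ideal (𝓞 K)) × Ideal (𝓞 K)}
    (ht : t ∈ Upairs X τ n) (hg : UGood t) (hle : (Ideal.absNorm (uIdeal t) : ℝ) ≤ X ^ (3 / 2 - τ))
    (hf : X ^ (3 / 2 - τ - (n + 1) * hbXi τ) < (Ideal.absNorm (uIdeal t) : ℝ)) :
    ∃ h : ((insert t.2 t.1).image Ideal.absNorm).Nonempty,
      let σ := (insert t.2 t.1).image Ideal.absNorm
      let σ' := σ.erase (σ.max' h)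
      let lo : ℝ := X ^ (3 / 2 - τ - (n + 1) * hbXi τ) / ∏ p ∈ σ', (p : ℝ)
      0 < lo ∧ lo < (σ.max' h : ℝ) ∧ (σ.max' h : ℝ) ≤ lo * X ^ ((n + 1) * hbXi τ) := by
  classical
  have hX0 : 0 < X := by linarith
  obtain ⟨hne, hprod, -, -⟩ := pattern_max_min ht hg
  obtain ⟨-, -, hprodN, -⟩ := pattern_props ht hg
  refine ⟨hne, ?_⟩
  set σ := (insert t.2 t.1).image Ideal.absNorm with hσ
  set p₁ := σ.max' hne with hp₁
  set D : ℝ := ∏ p ∈ σ.erase p₁, (p : ℝ) with hD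
  have hD0 : 0 < D := by
    rw [hD]; refine prod_pos fun p hp => ?_
    obtain ⟨Q, hQ, rfl⟩ := mem_image.mp (mem_of_mem_erase hp)
    exact_mod_cast (hg.1 Q hQ).pos
  have hN : (Ideal.absNorm (uIdeal t) : ℝ) = p₁ * D := by
    rw [← hprodN, Nat.cast_prod, hprod]
  simp only
  refine ⟨by positivity, ?_, ?_⟩
  · rw [div_lt_iff₀ hD0, ← hN]; exact hf
  · rw [div_mul_eq_mul_div, le_div_iff₀ hD0, ← Real.rpow_add hX0, ← hN]
    have : 3 / 2 - τ - (n + 1) * hbXi τ + (n + 1) * hbXi τ = 3 / 2 - τ := by ring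
    rw [this]; exact hle

end Patterns

end Literature.NumberTheory.Sieve.CubicSieve

end


/-! ## Part 3: (E2) and (E5) through Lemma 7.1 -/

noncomputable section

open Polynomial NumberField Finset Filter Topology Asymptotics
open scoped nonZeroDivisors

namespace Literature.NumberTheory.Sieve.CubicSieve

open LFunctions.CubeRootTwoField CubicPrimes
open Literature.NumberTheory.LFunctions (idealNormCount)

section E2E5

variable {ι : Type*} (E : Finset ι) (I : ι → Ideal (𝓞 K)) {X τ C₇ C₁ M Err : ℝ} {n : ℕ}

/-- **Lemma 7.1 for a family of good chain indices** (level `X^τ`, range `[X^{1+τ}, 2X^{3/2−τ})`):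
`∑_{t∈T} S_K(𝒵_{P_1⋯P_{n+1}}, X^τ) ≤ C₇ (M/(τ log X)) ∑_{σ ∈ patterns(T)} ∏_{p∈σ} c_K(p)/p + 3 log X · C₇ Err`
(re-index by the ideal, embed into `normIn`, sum dyadically, pass to norm patterns).
[cite: HeathBrownActa2001, §7 (7.3)] -/
theorem sum_good_family_le (hX : (2 : ℝ) ^ 15 ≤ X) (hτ : 0 < τ) (hτ1 : τ ≤ 1 / 8)
    (hXτ2 : 2 * X ^ τ ≤ X ^ (1 / 2 : ℝ)) (hC₇ : 0 ≤ C₇) (hM : 0 ≤ M) (hErr : 0 ≤ Err)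
    (h7 : ∀ (N z : ℝ) (𝒬 : Finset ℕ), X ^ τ ≤ z → 0 < N → N ≤ X ^ (2 - 2 * τ) →
        (∀ q ∈ 𝒬, Squarefree q ∧ N < q ∧ (q : ℝ) ≤ 2 * N) →
        ∑ Q ∈ normIn 𝒬, (famSifted E I Q z : ℝ) ≤
          C₇ * (M / Real.log (min z (X ^ (2 - τ) / N)) *
            ∑ Q ∈ normIn 𝒬, ((Ideal.absNorm Q : ℕ) : ℝ)⁻¹ + Err))
    (T : Finset (Finset (Ideal (𝓞 K)) × Ideal (𝓞 K)))
    (hT : ∀ t ∈ T, t ∈ Upairs X τ n ∧ UGood t ∧ (Ideal.absNorm (uIdeal t) : ℝ) ≤ X ^ (3 / 2 - τ)) :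
    ∑ t ∈ T, (famSifted E I (uIdeal t) (X ^ τ) : ℝ) ≤
      C₇ * (M / (τ * Real.log X)) *
          ∑ σ ∈ T.image (fun t => (insert t.2 t.1).image Ideal.absNorm),
            ∏ p ∈ σ, (idealNormCount K p : ℝ) * (p : ℝ)⁻¹ +
        3 * Real.log X * (C₇ * Err) := by
  classical
  have hX1 : 1 < X := lt_of_lt_of_le (by norm_num) hX
  have hX0 : 0 < X := by linarith
  set L := Real.log X with hL
  have hL10 : 10 ≤ L := ten_le_log hX
  have hL0 : 0 < L := by linarith
  -- re-index by the ideal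
  have hinj : Set.InjOn uIdeal (T : Set _) := (uIdeal_injOn X τ n).mono fun t ht => (hT t ht).1
  have step1 : ∑ t ∈ T, (famSifted E I (uIdeal t) (X ^ τ) : ℝ) =
      ∑ Q ∈ T.image uIdeal, (famSifted E I Q (X ^ τ) : ℝ) := by
    rw [sum_image hinj]
  -- Lemma 7.1 on `[X^{1+τ}, 2X^{3/2−τ})` at level `X^τ`
  set a : ℝ := X ^ (1 + τ) with ha
  set b : ℝ := 2 * X ^ (3 / 2 - τ) with hb
  have ha2 : 2 ≤ a := by
    have : X ^ (1 : ℝ) ≤ X ^ (1 + τ) := Real.rpow_le_rpow_of_exponent_le hX1.le (by linarith)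
    rw [Real.rpow_one] at this; rw [ha]; linarith
  have hab : a ≤ b := by
    have h1 : X ^ (1 + τ) ≤ X ^ (3 / 2 - τ) := Real.rpow_le_rpow_of_exponent_le hX1.le (by linarith)
    have h2 : 0 ≤ X ^ (3 / 2 - τ) := Real.rpow_nonneg hX0.le _
    rw [ha, hb]; linarith
  have hkey : X ^ (2 - τ) / b = X ^ (1 / 2 : ℝ) / 2 := by
    have h1 : X ^ (2 - τ) = X ^ (1 / 2 : ℝ) * X ^ (3 / 2 - τ) := by
      rw [← Real.rpow_add hX0]; ring_nf
    have h2 : 0 < X ^ (3 / 2 - τ) := Real.rpow_pos_of_pos hX0 _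
    rw [hb, h1]; field_simp
  have hbX : b ≤ X ^ (2 - 2 * τ) := by
    have h1 : X ^ (2 - 2 * τ) = X ^ (3 / 2 - τ) * X ^ (1 / 2 - τ) := by
      rw [← Real.rpow_add hX0]; ring_nf
    have h2 : (2 : ℝ) ≤ X ^ (1 / 2 - τ) := by
      have : X ^ (1 / 2 - τ) = X ^ (1 / 2 : ℝ) / X ^ τ := by rw [← Real.rpow_sub hX0]
      rw [this, le_div_iff₀ (Real.rpow_pos_of_pos hX0 _)]; linarith
    rw [hb, h1]
    have h0 : 0 ≤ X ^ (3 / 2 - τ) := Real.rpow_nonneg hX0.le _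
    nlinarith
  have hmin : min (X ^ τ) (X ^ (2 - τ) / b) = X ^ τ := by
    rw [hkey]; exact min_eq_left (by linarith)
  have hXτ1 : 1 < X ^ τ := Real.one_lt_rpow hX1 hτ
  have hm1 : 1 < min (X ^ τ) (X ^ (2 - τ) / b) := by rw [hmin]; exact hXτ1
  have hlogmin : Real.log (min (X ^ τ) (X ^ (2 - τ) / b)) = τ * L := by rw [hmin, Real.log_rpow hX0]
  have h7z : ∀ (N : ℝ) (𝒬 : Finset ℕ), 0 < N → N ≤ X ^ (2 - 2 * τ) →
      (∀ q ∈ 𝒬, Squarefree q ∧ N < q ∧ (q : ℝ) ≤ 2 * N) →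
      ∑ Q ∈ normIn 𝒬, (famSifted E I Q (X ^ τ) : ℝ) ≤
        C₇ * (M / Real.log (min (X ^ τ) (X ^ (2 - τ) / N)) *
          ∑ Q ∈ normIn 𝒬, ((Ideal.absNorm Q : ℕ) : ℝ)⁻¹ + Err) :=
    fun N 𝒬 hN hNX h𝒬 => h7 N (X ^ τ) 𝒬 le_rfl hN hNX h𝒬
  have hTimg : ∀ Q ∈ T.image uIdeal, Squarefree (Ideal.absNorm Q) ∧ a ≤ (Ideal.absNorm Q : ℝ) ∧
      (Ideal.absNorm Q : ℝ) < b := by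
    intro Q hQ
    obtain ⟨t, ht, rfl⟩ := mem_image.mp hQ
    obtain ⟨htU, hg, hle⟩ := hT t ht
    refine ⟨squarefree_absNorm_uIdeal (snd_notMem_fst htU) hg, ?_, ?_⟩
    · rw [ha, absNorm_uIdeal]; exact_mod_cast (mem_Upairs_iff.mp htU).2.2.2
    · rw [hb]
      have : 0 < X ^ (3 / 2 - τ) := Real.rpow_pos_of_pos hX0 _
      linarith
  have step2 := sum_le_of_image_normIn (fun Q => Nat.cast_nonneg _) h7z hC₇ hM hErr hX0 ha2 hab hbX hm1
    (T.image uIdeal) hTimg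
  rw [hlogmin] at step2
  -- the weight through patterns
  have hTg : ∀ t ∈ T, t ∈ Upairs X τ n ∧ UGood t := fun t ht => ⟨(hT t ht).1, (hT t ht).2.1⟩
  have step3 : ∑ q ∈ (T.image uIdeal).image Ideal.absNorm, (idealNormCount K q : ℝ) * (q : ℝ)⁻¹ ≤
      ∑ σ ∈ T.image (fun t => (insert t.2 t.1).image Ideal.absNorm),
        ∏ p ∈ σ, (idealNormCount K p : ℝ) * (p : ℝ)⁻¹ := by
    rw [image_image]
    exact sum_image_absNorm_uIdeal_le T hTg
  have hblocks : Real.log b / Real.log 2 + 1 ≤ 3 * L := by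
    refine log_div_log_two_add_one_le (by linarith) ?_ hL hL10
    calc b ≤ X ^ (2 - 2 * τ) := hbX
      _ ≤ X ^ ((2 : ℕ) : ℝ) := Real.rpow_le_rpow_of_exponent_le hX1.le (by norm_num; linarith)
      _ = X ^ 2 := Real.rpow_natCast X 2
  have hcoef : 0 ≤ C₇ * (M / (τ * L)) := by positivity
  calc ∑ t ∈ T, (famSifted E I (uIdeal t) (X ^ τ) : ℝ)
      = ∑ Q ∈ T.image uIdeal, (famSifted E I Q (X ^ τ) : ℝ) := step1
    _ ≤ C₇ * (M / (τ * L) * ∑ q ∈ (T.image uIdeal).image Ideal.absNorm, (idealNormCount K q : ℝ) * (q : ℝ)⁻¹) +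
          (Real.log b / Real.log 2 + 1) * (C₇ * Err) := step2
    _ ≤ C₇ * (M / (τ * L)) * ∑ σ ∈ T.image (fun t => (insert t.2 t.1).image Ideal.absNorm),
            ∏ p ∈ σ, (idealNormCount K p : ℝ) * (p : ℝ)⁻¹ + 3 * L * (C₇ * Err) := by
        rw [← mul_assoc]
        exact add_le_add (mul_le_mul_of_nonneg_left step3 hcoef)
          (mul_le_mul_of_nonneg_right hblocks (by positivity))

open scoped Classical in
/-- **(E2) as a pattern weight.** The norm patterns of the unmatched good chain indices (the six
edge/close classes of p. 43) have total weight at most `5·B_w·e_n(P0) + (∑_{P0} w)·B_w·e_{n−1}(P0)`,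
where `B_w = 2((n+1)ξ log X + log 2 + C₁)/(τ log X)` bounds every window weight that occurs
(fixed windows of logarithmic width `ξ`, floating windows of width `nξ`, `(n+1)ξ`), `w(p) = c_K(p)/p`,
`e_j` the elementary symmetric sums over `P0 = {X^τ ≤ p < X^{1−τ}}` and `n ≥ 1`.
[cite: HeathBrownActa2001, §7 p. 43] -/
theorem E2_pattern_weight_le (hC₁ : 0 ≤ C₁)
    (hwin : ∀ (lo hi : ℝ) (T : Finset ℕ), 2 ≤ lo → lo ≤ hi →
      (∀ p ∈ T, p.Prime ∧ lo < (p : ℝ) ∧ (p : ℝ) ≤ hi) →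
      ∑ p ∈ T, (idealNormCount K p : ℝ) * (p : ℝ)⁻¹ ≤
        Real.log (Real.log hi / Real.log lo) + C₁ / Real.log lo)
    (hX : 1 < X) (hτ : 0 < τ) (hXτ : 4 ≤ X ^ τ) (hn : 1 ≤ n) :
    ∑ σ ∈ ((Upairs X τ n).filter (fun t => UGood t ∧
          (Ideal.absNorm (uIdeal t) : ℝ) ≤ X ^ (3 / 2 - τ) ∧
          ((∃ Q ∈ insert t.2 t.1, (Ideal.absNorm Q : ℝ) < X ^ (τ + hbXi τ)) ∨
           (∃ Q ∈ insert t.2 t.1, X ^ (1 - τ - hbXi τ) ≤ (Ideal.absNorm Q : ℝ)) ∨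
           (X ^ (1 + τ - n * hbXi τ) < (Ideal.absNorm (∏ P ∈ t.1, P) : ℝ)) ∨
           ((Ideal.absNorm (uIdeal t) : ℝ) < X ^ (1 + τ + (n + 1) * hbXi τ)) ∨
           (∃ Q ∈ insert t.2 t.1, ∃ Q' ∈ insert t.2 t.1, Ideal.absNorm Q < Ideal.absNorm Q' ∧
              (Ideal.absNorm Q' : ℝ) < Ideal.absNorm Q * X ^ hbXi τ) ∨
           (X ^ (3 / 2 - τ - (n + 1) * hbXi τ) < (Ideal.absNorm (uIdeal t) : ℝ))))).image
          (fun t => (insert t.2 t.1).image Ideal.absNorm),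
        ∏ p ∈ σ, (idealNormCount K p : ℝ) * (p : ℝ)⁻¹ ≤
      5 * (2 * ((n + 1) * hbXi τ * Real.log X + Real.log 2 + C₁) / (τ * Real.log X)) *
          ∑ σ' ∈ ((range (⌊X ^ (1 - τ)⌋₊ + 1)).filter
              (fun p : ℕ => p.Prime ∧ X ^ τ ≤ (p : ℝ) ∧ (p : ℝ) < X ^ (1 - τ))).powersetCard n,
            ∏ p ∈ σ', (idealNormCount K p : ℝ) * (p : ℝ)⁻¹ +
      (∑ p ∈ (range (⌊X ^ (1 - τ)⌋₊ + 1)).filter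
          (fun p : ℕ => p.Prime ∧ X ^ τ ≤ (p : ℝ) ∧ (p : ℝ) < X ^ (1 - τ)), (idealNormCount K p : ℝ) * (p : ℝ)⁻¹) *
        (2 * ((n + 1) * hbXi τ * Real.log X + Real.log 2 + C₁) / (τ * Real.log X)) *
          ∑ σ' ∈ ((range (⌊X ^ (1 - τ)⌋₊ + 1)).filter
              (fun p : ℕ => p.Prime ∧ X ^ τ ≤ (p : ℝ) ∧ (p : ℝ) < X ^ (1 - τ))).powersetCard (n - 1),
            ∏ p ∈ σ', (idealNormCount K p : ℝ) * (p : ℝ)⁻¹ := by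
  classical
  obtain ⟨n', rfl⟩ : ∃ n', n = n' + 1 := ⟨n - 1, by omega⟩
  rw [Nat.add_sub_cancel]
  have hX0 : 0 < X := by linarith
  have hL : 0 < Real.log X := Real.log_pos hX
  have hξ := hbXi_pos hτ
  have hl2 : 0 < Real.log 2 := Real.log_pos one_lt_two
  set P0 := (range (⌊X ^ (1 - τ)⌋₊ + 1)).filter
    (fun p : ℕ => p.Prime ∧ X ^ τ ≤ (p : ℝ) ∧ (p : ℝ) < X ^ (1 - τ)) with hP0
  set w : ℕ → ℝ := fun p => (idealNormCount K p : ℝ) * (p : ℝ)⁻¹ with hw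
  set Bw : ℝ := 2 * ((((n' + 1 : ℕ) : ℝ) + 1) * hbXi τ * Real.log X + Real.log 2 + C₁) / (τ * Real.log X) with hBw
  set en : ℝ := ∑ σ' ∈ P0.powersetCard (n' + 1), ∏ p ∈ σ', w p with hen
  set en1 : ℝ := ∑ σ' ∈ P0.powersetCard n', ∏ p ∈ σ', w p with hen1
  set Lt : ℝ := ∑ p ∈ P0, w p with hLt
  have hP0mem : ∀ p ∈ P0, p.Prime ∧ X ^ τ ≤ (p : ℝ) := fun p hp =>
    ⟨(mem_P0_iff.mp hp).1, (mem_P0_iff.mp hp).2.1⟩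
  have hen0 : 0 ≤ en := esymm_nonneg P0 w (normWt_nonneg_on P0) _
  have hen10 : 0 ≤ en1 := esymm_nonneg P0 w (normWt_nonneg_on P0) _
  have hLt0 : 0 ≤ Lt := sum_nonneg (normWt_nonneg_on P0)
  have hτL : 0 < τ * Real.log X := by positivity
  have hkξ : 0 ≤ (((n' + 1 : ℕ) : ℝ) + 1) * hbXi τ * Real.log X := by positivity
  have hBw0 : 0 ≤ Bw := by rw [hBw]; positivity
  -- the six sub-families of chain indices
  set hleP := fun t : Finset (Ideal (𝓞 K)) × Ideal (𝓞 K) =>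
    (Ideal.absNorm (uIdeal t) : ℝ) ≤ X ^ (3 / 2 - τ) with hhleP
  set ca := fun t : Finset (Ideal (𝓞 K)) × Ideal (𝓞 K) =>
    ∃ Q ∈ insert t.2 t.1, (Ideal.absNorm Q : ℝ) < X ^ (τ + hbXi τ) with hca
  set cb := fun t : Finset (Ideal (𝓞 K)) × Ideal (𝓞 K) =>
    ∃ Q ∈ insert t.2 t.1, X ^ (1 - τ - hbXi τ) ≤ (Ideal.absNorm Q : ℝ) with hcb
  set cc := fun t : Finset (Ideal (𝓞 K)) × Ideal (𝓞 K) =>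
    X ^ (1 + τ - ((n' + 1 : ℕ) : ℝ) * hbXi τ) < (Ideal.absNorm (∏ P ∈ t.1, P) : ℝ) with hcc
  set cd := fun t : Finset (Ideal (𝓞 K)) × Ideal (𝓞 K) =>
    (Ideal.absNorm (uIdeal t) : ℝ) < X ^ (1 + τ + (((n' + 1 : ℕ) : ℝ) + 1) * hbXi τ) with hcd
  set ce := fun t : Finset (Ideal (𝓞 K)) × Ideal (𝓞 K) =>
    ∃ Q ∈ insert t.2 t.1, ∃ Q' ∈ insert t.2 t.1, Ideal.absNorm Q < Ideal.absNorm Q' ∧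
      (Ideal.absNorm Q' : ℝ) < Ideal.absNorm Q * X ^ hbXi τ with hce
  set cf := fun t : Finset (Ideal (𝓞 K)) × Ideal (𝓞 K) =>
    X ^ (3 / 2 - τ - (((n' + 1 : ℕ) : ℝ) + 1) * hbXi τ) < (Ideal.absNorm (uIdeal t) : ℝ) with hcf
  set pat := fun t : Finset (Ideal (𝓞 K)) × Ideal (𝓞 K) => (insert t.2 t.1).image Ideal.absNorm with hpat
  set U := Upairs X τ (n' + 1) with hU
  set Ta := U.filter (fun t => UGood t ∧ hleP t ∧ ca t) with hTa
  set Tb := U.filter (fun t => UGood t ∧ hleP t ∧ cb t) with hTb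
  set Tc := U.filter (fun t => UGood t ∧ hleP t ∧ cc t) with hTc
  set Td := U.filter (fun t => UGood t ∧ hleP t ∧ cd t) with hTd
  set Te := U.filter (fun t => UGood t ∧ hleP t ∧ ce t) with hTe
  set Tf := U.filter (fun t => UGood t ∧ hleP t ∧ cf t) with hTf
  have hgoodTa : ∀ t ∈ Ta, t ∈ Upairs X τ (n' + 1) ∧ UGood t := fun t ht =>
    ⟨(mem_filter.mp ht).1, (mem_filter.mp ht).2.1⟩
  have hgoodTb : ∀ t ∈ Tb, t ∈ Upairs X τ (n' + 1) ∧ UGood t := fun t ht =>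
    ⟨(mem_filter.mp ht).1, (mem_filter.mp ht).2.1⟩
  have hgoodTc : ∀ t ∈ Tc, t ∈ Upairs X τ (n' + 1) ∧ UGood t := fun t ht =>
    ⟨(mem_filter.mp ht).1, (mem_filter.mp ht).2.1⟩
  have hgoodTd : ∀ t ∈ Td, t ∈ Upairs X τ (n' + 1) ∧ UGood t := fun t ht =>
    ⟨(mem_filter.mp ht).1, (mem_filter.mp ht).2.1⟩
  have hgoodTe : ∀ t ∈ Te, t ∈ Upairs X τ (n' + 1) ∧ UGood t := fun t ht =>
    ⟨(mem_filter.mp ht).1, (mem_filter.mp ht).2.1⟩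
  have hgoodTf : ∀ t ∈ Tf, t ∈ Upairs X τ (n' + 1) ∧ UGood t := fun t ht =>
    ⟨(mem_filter.mp ht).1, (mem_filter.mp ht).2.1⟩
  -- the image splits over the six families
  have hcover : (U.filter (fun t => UGood t ∧ hleP t ∧ (ca t ∨ cb t ∨ cc t ∨ cd t ∨ ce t ∨ cf t))).image pat ⊆
      Ta.image pat ∪ Tb.image pat ∪ Tc.image pat ∪ Td.image pat ∪ Te.image pat ∪ Tf.image pat := by
    intro σ hσ
    obtain ⟨t, ht, rfl⟩ := mem_image.mp hσ
    obtain ⟨htU, hg, hb, hcls⟩ := mem_filter.mp ht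
    simp only [mem_union]
    rcases hcls with h | h | h | h | h | h
    · exact Or.inl (Or.inl (Or.inl (Or.inl (Or.inl (mem_image_of_mem _ (mem_filter.mpr ⟨htU, hg, hb, h⟩))))))
    · exact Or.inl (Or.inl (Or.inl (Or.inl (Or.inr (mem_image_of_mem _ (mem_filter.mpr ⟨htU, hg, hb, h⟩))))))
    · exact Or.inl (Or.inl (Or.inl (Or.inr (mem_image_of_mem _ (mem_filter.mpr ⟨htU, hg, hb, h⟩)))))
    · exact Or.inl (Or.inl (Or.inr (mem_image_of_mem _ (mem_filter.mpr ⟨htU, hg, hb, h⟩))))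
    · exact Or.inl (Or.inr (mem_image_of_mem _ (mem_filter.mpr ⟨htU, hg, hb, h⟩)))
    · exact Or.inr (mem_image_of_mem _ (mem_filter.mpr ⟨htU, hg, hb, h⟩))
  have hf0 : ∀ σ : Finset ℕ, 0 ≤ ∏ p ∈ σ, w p := fun σ => prod_nonneg fun p _ => normWt_nonneg p
  -- window weights
  have hWa : ∑ p ∈ P0.filter (fun p : ℕ => (p : ℝ) < X ^ (τ + hbXi τ)), w p ≤ Bw := by
    have hlo : 0 < X ^ τ / 2 := by positivity
    have h := floating_window_normWt_le hC₁ hwin hX hτ hXτ hlo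
      (show X ^ τ / 2 ≤ X ^ (τ + hbXi τ) by
        have : X ^ τ ≤ X ^ (τ + hbXi τ) := Real.rpow_le_rpow_of_exponent_le hX.le (by linarith)
        linarith)
      (P0.filter fun p : ℕ => (p : ℝ) < X ^ (τ + hbXi τ)) (fun p hp => by
        rw [mem_filter] at hp
        exact ⟨(hP0mem p hp.1).1, (hP0mem p hp.1).2, by linarith [(hP0mem p hp.1).2], hp.2.le⟩)
    have hratio : Real.log (X ^ (τ + hbXi τ) / (X ^ τ / 2)) = hbXi τ * Real.log X + Real.log 2 := by
      rw [div_div_eq_mul_div, Real.log_div (by positivity) (by positivity), Real.log_mul (by positivity) two_ne_zero,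
        Real.log_rpow hX0, Real.log_rpow hX0]; ring
    rw [hratio] at h
    refine h.trans ?_
    rw [hBw]
    refine div_le_div_of_nonneg_right ?_ hτL.le
    nlinarith [mul_nonneg (mul_nonneg (Nat.cast_nonneg (n' + 1)) hξ.le) hL.le]
  have hWb : ∑ p ∈ P0.filter (fun p : ℕ => X ^ (1 - τ - hbXi τ) ≤ (p : ℝ)), w p ≤ Bw := by
    have hlo : 0 < X ^ (1 - τ - hbXi τ) / 2 := by positivity
    have h := floating_window_normWt_le hC₁ hwin hX hτ hXτ hlo
      (show X ^ (1 - τ - hbXi τ) / 2 ≤ X ^ (1 - τ) by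
        have : X ^ (1 - τ - hbXi τ) ≤ X ^ (1 - τ) := Real.rpow_le_rpow_of_exponent_le hX.le (by linarith)
        linarith [Real.rpow_nonneg hX0.le (1 - τ - hbXi τ)])
      (P0.filter fun p : ℕ => X ^ (1 - τ - hbXi τ) ≤ (p : ℝ)) (fun p hp => by
        rw [mem_filter] at hp
        exact ⟨(hP0mem p hp.1).1, (hP0mem p hp.1).2, by linarith [hp.2], (mem_P0_iff.mp hp.1).2.2.le⟩)
    have hratio : Real.log (X ^ (1 - τ) / (X ^ (1 - τ - hbXi τ) / 2)) = hbXi τ * Real.log X + Real.log 2 := by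
      rw [div_div_eq_mul_div, Real.log_div (by positivity) (by positivity), Real.log_mul (by positivity) two_ne_zero,
        Real.log_rpow hX0, Real.log_rpow hX0]; ring
    rw [hratio] at h
    refine h.trans ?_
    rw [hBw]
    refine div_le_div_of_nonneg_right ?_ hτL.le
    nlinarith [mul_nonneg (mul_nonneg (Nat.cast_nonneg (n' + 1)) hξ.le) hL.le]
  -- (a), (b)
  have hA : ∑ σ ∈ Ta.image pat, ∏ p ∈ σ, w p ≤ Bw * en :=
    sum_class_window_le P0 _ (image_pattern_subset (n := n' + 1) Ta hgoodTa) (fun p : ℕ => (p : ℝ) < X ^ (τ + hbXi τ))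
      (fun σ hσ => by
        obtain ⟨t, ht, rfl⟩ := mem_image.mp hσ
        obtain ⟨Q, hQ, hQlt⟩ := (mem_filter.mp ht).2.2.2
        exact ⟨Ideal.absNorm Q, mem_image_of_mem _ hQ, hQlt⟩) hWa
  have hB : ∑ σ ∈ Tb.image pat, ∏ p ∈ σ, w p ≤ Bw * en :=
    sum_class_window_le P0 _ (image_pattern_subset (n := n' + 1) Tb hgoodTb) (fun p : ℕ => X ^ (1 - τ - hbXi τ) ≤ (p : ℝ))
      (fun σ hσ => by
        obtain ⟨t, ht, rfl⟩ := mem_image.mp hσ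
        obtain ⟨Q, hQ, hQle⟩ := (mem_filter.mp ht).2.2.2
        exact ⟨Ideal.absNorm Q, mem_image_of_mem _ hQ, hQle⟩) hWb
  -- (c)
  have hρc : (1 : ℝ) ≤ X ^ (((n' + 1 : ℕ) : ℝ) * hbXi τ) := Real.one_le_rpow hX.le (by positivity)
  have hC : ∑ σ ∈ Tc.image pat, ∏ p ∈ σ, w p ≤ Bw * en := by
    have h := sum_class_floating_le P0 hC₁ hwin hX hτ hXτ hP0mem _ (image_pattern_subset (n := n' + 1) Tc hgoodTc)
      (fun σ' => if h' : σ'.Nonempty then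
          X ^ (1 + τ - ((n' + 1 : ℕ) : ℝ) * hbXi τ) / ∏ p ∈ σ'.erase (σ'.min' h'), (p : ℝ) else 1) hρc
      (fun σ hσ => by
        obtain ⟨t, ht, rfl⟩ := mem_image.mp hσ
        obtain ⟨htU, hg, -, hc⟩ := mem_filter.mp ht
        exact classC_window hX (Nat.succ_le_succ (Nat.zero_le _)) htU hg hc)
    refine h.trans (mul_le_mul_of_nonneg_right ?_ hen0)
    rw [Real.log_rpow hX0, hBw]
    refine div_le_div_of_nonneg_right ?_ hτL.le
    nlinarith [mul_nonneg hξ.le hL.le]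
  -- (d)
  have hρd : (1 : ℝ) ≤ 2 * X ^ ((((n' + 1 : ℕ) : ℝ) + 1) * hbXi τ) := by
    have := Real.one_le_rpow hX.le (show 0 ≤ (((n' + 1 : ℕ) : ℝ) + 1) * hbXi τ by positivity); linarith
  have hD : ∑ σ ∈ Td.image pat, ∏ p ∈ σ, w p ≤ Bw * en := by
    have h := sum_class_floating_le P0 hC₁ hwin hX hτ hXτ hP0mem _ (image_pattern_subset (n := n' + 1) Td hgoodTd)
      (fun σ' => X ^ (1 + τ) / (2 * ∏ p ∈ σ', (p : ℝ))) hρd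
      (fun σ hσ => by
        obtain ⟨t, ht, rfl⟩ := mem_image.mp hσ
        obtain ⟨htU, hg, -, hd⟩ := mem_filter.mp ht
        exact classD_window hX htU hg hd)
    refine h.trans (mul_le_mul_of_nonneg_right (le_of_eq ?_) hen0)
    rw [Real.log_mul two_ne_zero (by positivity), Real.log_rpow hX0, hBw]
    ring
  -- (f)
  have hρf : (1 : ℝ) ≤ X ^ ((((n' + 1 : ℕ) : ℝ) + 1) * hbXi τ) := Real.one_le_rpow hX.le (by positivity)
  have hF : ∑ σ ∈ Tf.image pat, ∏ p ∈ σ, w p ≤ Bw * en := by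
    have h := sum_class_floating_le P0 hC₁ hwin hX hτ hXτ hP0mem _ (image_pattern_subset (n := n' + 1) Tf hgoodTf)
      (fun σ' => X ^ (3 / 2 - τ - (((n' + 1 : ℕ) : ℝ) + 1) * hbXi τ) / ∏ p ∈ σ', (p : ℝ)) hρf
      (fun σ hσ => by
        obtain ⟨t, ht, rfl⟩ := mem_image.mp hσ
        obtain ⟨htU, hg, hle, hf⟩ := mem_filter.mp ht
        exact classF_window hX htU hg hle hf)
    refine h.trans (mul_le_mul_of_nonneg_right ?_ hen0)
    rw [Real.log_rpow hX0, hBw]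
    refine div_le_div_of_nonneg_right ?_ hτL.le
    nlinarith
  -- (e)
  have hρe : (1 : ℝ) ≤ X ^ hbXi τ := Real.one_le_rpow hX.le hξ.le
  have hE : ∑ σ ∈ Te.image pat, ∏ p ∈ σ, w p ≤ Lt * Bw * en1 := by
    have h := sum_class_close_le P0 hC₁ hwin hX hτ hXτ hP0mem _ (image_pattern_subset (n := n' + 1) Te hgoodTe) hρe
      (fun σ hσ => by
        obtain ⟨t, ht, rfl⟩ := mem_image.mp hσ
        obtain ⟨Q, hQ, Q', hQ', hlt, hclose⟩ := (mem_filter.mp ht).2.2.2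
        exact ⟨Ideal.absNorm Q, mem_image_of_mem _ hQ, Ideal.absNorm Q', mem_image_of_mem _ hQ', hlt, hclose.le⟩)
    refine h.trans (mul_le_mul_of_nonneg_right (mul_le_mul_of_nonneg_left ?_ hLt0) hen10)
    rw [Real.log_rpow hX0, hBw]
    refine div_le_div_of_nonneg_right ?_ hτL.le
    nlinarith [mul_nonneg (Nat.cast_nonneg (n' + 1)) (mul_nonneg hξ.le hL.le)]
  -- combine
  show ∑ σ ∈ (U.filter (fun t => UGood t ∧ hleP t ∧ (ca t ∨ cb t ∨ cc t ∨ cd t ∨ ce t ∨ cf t))).image pat,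
      ∏ p ∈ σ, w p ≤ 5 * Bw * en + Lt * Bw * en1
  calc ∑ σ ∈ (U.filter (fun t => UGood t ∧ hleP t ∧ (ca t ∨ cb t ∨ cc t ∨ cd t ∨ ce t ∨ cf t))).image pat, ∏ p ∈ σ, w p
      ≤ ∑ σ ∈ Ta.image pat ∪ Tb.image pat ∪ Tc.image pat ∪ Td.image pat ∪ Te.image pat ∪ Tf.image pat,
          ∏ p ∈ σ, w p := sum_le_sum_of_subset_of_nonneg hcover fun σ _ _ => hf0 σ
    _ ≤ ∑ σ ∈ Ta.image pat, ∏ p ∈ σ, w p + ∑ σ ∈ Tb.image pat, ∏ p ∈ σ, w p +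
          ∑ σ ∈ Tc.image pat, ∏ p ∈ σ, w p + ∑ σ ∈ Td.image pat, ∏ p ∈ σ, w p +
          ∑ σ ∈ Te.image pat, ∏ p ∈ σ, w p + ∑ σ ∈ Tf.image pat, ∏ p ∈ σ, w p := by
        have s1 := sum_union_le_add (Ta.image pat ∪ Tb.image pat ∪ Tc.image pat ∪ Td.image pat ∪ Te.image pat)
          (Tf.image pat) hf0
        have s2 := sum_union_le_add (Ta.image pat ∪ Tb.image pat ∪ Tc.image pat ∪ Td.image pat) (Te.image pat) hf0
        have s3 := sum_union_le_add (Ta.image pat ∪ Tb.image pat ∪ Tc.image pat) (Td.image pat) hf0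
        have s4 := sum_union_le_add (Ta.image pat ∪ Tb.image pat) (Tc.image pat) hf0
        have s5 := sum_union_le_add (Ta.image pat) (Tb.image pat) hf0
        linarith
    _ ≤ Bw * en + Bw * en + Bw * en + Bw * en + Lt * Bw * en1 + Bw * en := by
        linarith [hA, hB, hC, hD, hE, hF]
    _ = 5 * Bw * en + Lt * Bw * en1 := by ring

/-- The chain index of an admissible tuple is good (prime, pairwise distinct norms).
[cite: HeathBrownActa2001, §3 (3.5)] -/
theorem toPair_good (hX : 1 < X) (hτ : 0 < τ) (hτ1 : τ ≤ 1)
    {m : Fin (n + 1) → ℕ} (hm : m ∈ mIndexU τ n) {P : Fin (n + 1) → Ideal (𝓞 K)}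
    (hP : P ∈ Fintype.piFinset fun i => Jprimes X τ (m i)) :
    UGood ((univ : Finset (Fin n)).image (fun i => P (Fin.castSucc i)), P (Fin.last n)) := by
  classical
  obtain ⟨-, hJ, -, hSA, -⟩ := U_index_props hX hτ hτ1 hm hP
  have hmem : ∀ Q ∈ insert (P (Fin.last n)) ((univ : Finset (Fin n)).image (fun i => P (Fin.castSucc i))),
      ∃ j, Q = P j := by
    intro Q hQ
    rcases mem_insert.mp hQ with rfl | hQ
    · exact ⟨_, rfl⟩
    · obtain ⟨i, -, rfl⟩ := mem_image.mp hQ; exact ⟨_, rfl⟩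
  refine ⟨fun Q hQ => ?_, fun Q hQ Q' hQ' h => ?_⟩
  · obtain ⟨j, rfl⟩ := hmem Q hQ; exact (hJ j).2.2.1
  · obtain ⟨j, rfl⟩ := hmem Q hQ
    obtain ⟨j', rfl⟩ := hmem Q' hQ'
    rw [hSA.injective h]

/-- **(E5) through Lemma 7.1**: `∑_{(𝐦,P)} S_K(𝒵_{∏P}, X^τ) ≤ C₇ (M/(τ log X)) e_{n+1}(P0) + 3 log X · C₇ Err`
(the ideals `∏ P_i` of the admissible tuples are distinct, of square-free norm in
`[X^{1+τ}, X^{3/2−τ})`, and their norm patterns are `(n+1)`-subsets of `P0`). This is the bound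
"`U^(n)(𝒜) ≪ (η²X²/(τ log X)) (log τ^{-1})^{n+1}/(n+1)!`" of p. 44. [cite: HeathBrownActa2001, §7 p. 44] -/
theorem E5_le (hX : (2 : ℝ) ^ 15 ≤ X) (hτ : 0 < τ) (hτ1 : τ ≤ 1 / 8)
    (hXτ2 : 2 * X ^ τ ≤ X ^ (1 / 2 : ℝ)) (hC₇ : 0 ≤ C₇) (hM : 0 ≤ M) (hErr : 0 ≤ Err)
    (h7 : ∀ (N z : ℝ) (𝒬 : Finset ℕ), X ^ τ ≤ z → 0 < N → N ≤ X ^ (2 - 2 * τ) →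
        (∀ q ∈ 𝒬, Squarefree q ∧ N < q ∧ (q : ℝ) ≤ 2 * N) →
        ∑ Q ∈ normIn 𝒬, (famSifted E I Q z : ℝ) ≤
          C₇ * (M / Real.log (min z (X ^ (2 - τ) / N)) *
            ∑ Q ∈ normIn 𝒬, ((Ideal.absNorm Q : ℕ) : ℝ)⁻¹ + Err)) :
    ∑ b ∈ (mIndexU τ n).sigma (fun m => Fintype.piFinset fun i => Jprimes X τ (m i)),
        (famSifted E I (∏ j, b.2 j) (X ^ τ) : ℝ) ≤
      C₇ * (M / (τ * Real.log X)) *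
          ∑ σ' ∈ ((range (⌊X ^ (1 - τ)⌋₊ + 1)).filter
              (fun p : ℕ => p.Prime ∧ X ^ τ ≤ (p : ℝ) ∧ (p : ℝ) < X ^ (1 - τ))).powersetCard (n + 1),
            ∏ p ∈ σ', (idealNormCount K p : ℝ) * (p : ℝ)⁻¹ +
        3 * Real.log X * (C₇ * Err) := by
  classical
  have hX1 : 1 < X := lt_of_lt_of_le (by norm_num) hX
  have hτ1' : τ ≤ 1 := by linarith
  set A : Finset (Σ _ : Fin (n + 1) → ℕ, Fin (n + 1) → Ideal (𝓞 K)) :=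
    (mIndexU τ n).sigma fun m => Fintype.piFinset fun i => Jprimes X τ (m i) with hA
  set φ : (Σ _ : Fin (n + 1) → ℕ, Fin (n + 1) → Ideal (𝓞 K)) → Finset (Ideal (𝓞 K)) × Ideal (𝓞 K) :=
    fun b => ((univ : Finset (Fin n)).image (fun i => b.2 (Fin.castSucc i)), b.2 (Fin.last n)) with hφ
  have hinj : Set.InjOn φ A := toPair_injOn hX1 hτ hτ1'
  have hmemT : ∀ t ∈ A.image φ, t ∈ Upairs X τ n ∧ UGood t ∧ (Ideal.absNorm (uIdeal t) : ℝ) ≤ X ^ (3 / 2 - τ) := by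
    intro t ht
    obtain ⟨⟨m, P⟩, hb, rfl⟩ := mem_image.mp ht
    rw [hA, mem_sigma] at hb
    obtain ⟨hU, hu, hlt, -⟩ := toPair_mem hX1 hτ hτ1' hb.1 hb.2
    exact ⟨hU, toPair_good hX1 hτ hτ1' hb.1 hb.2, by rw [hu]; exact hlt.le⟩
  have step1 : ∑ b ∈ A, (famSifted E I (∏ j, b.2 j) (X ^ τ) : ℝ) =
      ∑ t ∈ A.image φ, (famSifted E I (uIdeal t) (X ^ τ) : ℝ) := by
    rw [sum_image hinj]
    refine sum_congr rfl fun b hb => ?_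
    obtain ⟨m, P⟩ := b
    rw [hA, mem_sigma] at hb
    rw [(toPair_mem hX1 hτ hτ1' hb.1 hb.2).2.1]
  have step2 := sum_good_family_le E I hX hτ hτ1 hXτ2 hC₇ hM hErr h7 (A.image φ) hmemT
  have step3 : ∑ σ ∈ (A.image φ).image (fun t => (insert t.2 t.1).image Ideal.absNorm),
      ∏ p ∈ σ, (idealNormCount K p : ℝ) * (p : ℝ)⁻¹ ≤
      ∑ σ' ∈ ((range (⌊X ^ (1 - τ)⌋₊ + 1)).filter
          (fun p : ℕ => p.Prime ∧ X ^ τ ≤ (p : ℝ) ∧ (p : ℝ) < X ^ (1 - τ))).powersetCard (n + 1),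
        ∏ p ∈ σ', (idealNormCount K p : ℝ) * (p : ℝ)⁻¹ :=
    sum_le_sum_of_subset_of_nonneg (image_pattern_subset _ fun t ht => ⟨(hmemT t ht).1, (hmemT t ht).2.1⟩)
      fun σ _ _ => prod_nonneg fun p _ => normWt_nonneg p
  have hX0 : 0 < X := by linarith
  have hcoef : 0 ≤ C₇ * (M / (τ * Real.log X)) := by
    have := Real.log_pos hX1; positivity
  rw [step1]
  exact step2.trans (add_le_add (mul_le_mul_of_nonneg_left step3 hcoef) le_rfl)

end E2E5

end Literature.NumberTheory.Sieve.CubicSieve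

end
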